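import Summits.CriticalPhenomena.CardyFormulaZ2.Theorems.CardyIKTransportIKLinearTransportStubCoalescingRowKernelCuts
import Summits.CriticalPhenomena.CardyFormulaZ2.Theorems.CardyIKTransportIKLinearTransportStubConditionalRSWGlue

/-!
# Stub `stub_CoalescingRowKernel` (A_dyn') — part T: EXPONENTIAL TAIL of the distance to the last cut row

Support file (`--supports stmt-CriticalPhenomena-5076`, registered sub-goal `isCut_tail`). For EVERY
column pattern `S`, every face column `i`, every row `y` and depth `m`:

  `νmix S {x | no cut row of pinnedStat i x among the rows y-m-1, …, y-1} ≤ C e^{-c m}`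

with explicit absolute constants (`c = (5M)⁻¹`, `C = e^{4c}`, `M = (2K)^{15}`, `K = min(q,1-q)⁻⁴`,
`q = 2√3-3`). This is the `coal_tail` field of (A_dyn') for the certified-coalescence events "a cut row at
distance `≤ m+1` below" of `…StubCoalescingRowKernel.lean`, and it holds under the INPUT pattern `S`
directly — no use of `StripDiagramExchange`.

Proof: FINITE ENERGY, no Markov property, no large deviations. The window contains `⌊m/5⌋` disjoint
`3 × 5` blocks of strip cells; the local certificate `IsCutCert` of a block (`…Cuts.lean`) is a prescribed
colouring of its 15 cells and implies a cut row of the pinned statistic (`isCut_pinnedStat_of_cert`). By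
the single-cell flips of the gauge (`exists_cellFlip` with the row/column/plaquette flips of
`…StubConditionalRSWFlips/Cells`) an event determined OFF a block has probability at most `M` times that of
its intersection with the block's certificate (`crk_measure_le_of_pattern`, the prescribed-colour form of
`crsw_measure_preimage_le_of_cellFlips`); so "no certificate in the first `j` blocks" loses a factor
`1 - M⁻¹` with each further block (`crk_noCert_succ_le`), giving `(1 - M⁻¹)^{⌊m/5⌋} ≤ e^{4c} e^{-cm}`.
-/

noncomputable section

namespace Summit.CriticalPhenomena.CardyFormulaZ2.Theorems.IKLinearTransport.PinnedDiagramExchange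

open scoped Classical MeasureTheory ENNReal symmDiff
open Set MeasureTheory
open Literature.Probability.Percolation Literature.Probability.LatticeModels

/-! ## Finite energy with a prescribed colour pattern -/

/-- FINITE ENERGY, PRESCRIBED PATTERN: for an event `E` determined by `Λ`, a finite set `B` of cells off
`Λ` and any target colouring `col` of `B`, `μIK(obs⁻¹ E) ≤ (2K)^{|B|} μIK(obs⁻¹ E ∩ {B coloured as col})`.
[folklore] -/
theorem crk_measure_le_of_pattern {K : ℝ≥0∞}
    (hcell : ∀ c : Site 2, ∃ Φ : Ω → Ω, Measurable Φ ∧ μIK.map Φ ≤ K • μIK ∧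
      (∀ ω, (Φ ω).2.2.2.2 = ω.2.2.2.2) ∧
      ∀ (S : Set ℤ) (ω : Ω) (v : Site 2), v ∈ blackSet S (Φ ω) ↔ Xor (v ∈ blackSet S ω) (v = c))
    (S : Set ℤ) {Λ : Set (Site 2)} {E : Set Obs} (hE : E ∈ determinedOn Λ) (col : Site 2 → Prop)
    (B : Finset (Site 2)) (hB : ∀ c ∈ B, c ∉ Λ) :
    μIK (obs S ⁻¹' E) ≤
      (2 * K) ^ B.card * μIK (obs S ⁻¹' E ∩ {ω | ∀ c ∈ B, (c ∈ blackSet S ω ↔ col c)}) := by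
  -- adapted from `crsw_measure_preimage_le_of_cellFlips` (…StubConditionalRSWFiniteEnergy.lean)
  induction B using Finset.induction_on with
  | empty => simp
  | insert c B hcB ih =>
    have hB' : ∀ c' ∈ B, c' ∉ Λ := fun c' hc' => hB c' (Finset.mem_insert_of_mem hc')
    have hcΛ : c ∉ Λ := hB c (Finset.mem_insert_self c B)
    obtain ⟨Φ, hΦm, hΦb, hΦc, hΦt⟩ := hcell c
    have hK1 : 1 ≤ K := crsw_one_le_of_map_le hΦm hΦb
    set A := obs S ⁻¹' E ∩ {ω | ∀ c' ∈ B, (c' ∈ blackSet S ω ↔ col c')} with hA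
    set A' := obs S ⁻¹' E ∩ {ω | ∀ c' ∈ insert c B, (c' ∈ blackSet S ω ↔ col c')} with hA'
    set G : Set Ω := {ω | (c ∈ blackSet S ω ↔ col c)} with hG
    have h1 : A ∩ G ⊆ A' := by
      rintro ω ⟨⟨hωE, hωB⟩, hωc⟩
      refine ⟨hωE, fun c' hc' => ?_⟩
      rcases Finset.mem_insert.1 hc' with rfl | hc'B
      · exact hωc
      · exact hωB c' hc'B
    have h2 : A \ G ⊆ Φ ⁻¹' A' := by
      rintro ω ⟨⟨hωE, hωB⟩, hωc⟩
      refine ⟨(crsw_obs_mem_iff_of_cellFlip hE hcΛ hΦc hΦt S ω).2 hωE, fun c' hc' => ?_⟩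
      show c' ∈ blackSet S (Φ ω) ↔ col c'
      rw [hΦt, xor_def]
      rcases Finset.mem_insert.1 hc' with rfl | hc'B
      · simp only [hG, mem_setOf_eq] at hωc
        tauto
      · have hne : c' ≠ c := fun h => hcB (h ▸ hc'B)
        have h' := hωB c' hc'B
        tauto
    calc μIK (obs S ⁻¹' E) ≤ (2 * K) ^ B.card * μIK A := ih hB'
      _ ≤ (2 * K) ^ B.card * (μIK (A ∩ G) + μIK (A \ G)) :=
          mul_le_mul' le_rfl (measure_le_inter_add_sdiff _ _ _)
      _ ≤ (2 * K) ^ B.card * (μIK A' + K * μIK A') :=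
          mul_le_mul' le_rfl (add_le_add (measure_mono h1)
            ((measure_mono h2).trans (crsw_preimage_le_of_map_le hΦm hΦb A')))
      _ ≤ (2 * K) ^ B.card * (K * μIK A' + K * μIK A') :=
          mul_le_mul' le_rfl (add_le_add (le_mul_of_one_le_left bot_le hK1) le_rfl)
      _ = (2 * K) ^ (insert c B).card * μIK A' := by
          rw [Finset.card_insert_of_notMem hcB, pow_succ]; ring

/-! ## The certificate is a local, measurable event -/

/-- `IsCutCert i c` reads only the colours of the strip cells of the rows `c-2, …, c+2`. [folklore] -/
theorem isCutCert_congr (i c : ℤ) (x x' : Obs)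
    (h : ∀ v : Site 2, i ≤ v 0 → v 0 ≤ i + 2 → c - 2 ≤ v 1 → v 1 ≤ c + 2 → (v ∈ x.1 ↔ v ∈ x'.1)) :
    IsCutCert i c x ↔ IsCutCert i c x' := by
  have hv : ∀ a yy : ℤ, i ≤ a → a ≤ i + 2 → c - 2 ≤ yy → yy ≤ c + 2 →
      ((![a, yy] : Site 2) ∈ x.1 ↔ ![a, yy] ∈ x'.1) := fun a yy h1 h2 h3 h4 =>
    h _ (by simpa using h1) (by simpa using h2) (by simpa using h3) (by simpa using h4)
  have hc0 := hv i c le_rfl (by omega) (by omega) (by omega)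
  simp only [IsCutCert]
  rw [hc0, hv i (c - 2) le_rfl (by omega) (by omega) (by omega),
    hv i (c + 2) le_rfl (by omega) (by omega) (by omega)]
  refine and_congr ?_ (and_congr Iff.rfl (and_congr Iff.rfl ?_))
  · refine forall_congr' fun yy => forall_congr' fun h1 => forall_congr' fun h2 => ?_
    rw [hv i yy le_rfl (by omega) (by omega) (by omega), hv (i + 2) yy (by omega) le_rfl (by omega) (by omega)]
  · refine forall_congr' fun yy => forall_congr' fun h1 => forall_congr' fun h2 => ?_
    rw [hv (i + 1) yy (by omega) (by omega) h1 h2]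

/-- The certificate event is measurable. [folklore] -/
theorem measurableSet_isCutCert (i c : ℤ) : MeasurableSet {x : Obs | IsCutCert i c x} := by
  have hcell : ∀ v : Site 2, Measurable fun x : Obs => v ∈ x.1 := fun v =>
    (measurable_set_mem v).comp measurable_fst
  refine measurableSet_setOf.2 ?_
  unfold IsCutCert
  refine (Measurable.forall fun y => Measurable.imp measurable_const (Measurable.imp measurable_const
    (((hcell _).iff (hcell _)).and ((hcell _).iff (hcell _))))).and
    ((((hcell _).iff (hcell _).not)).and ((((hcell _).iff (hcell _).not)).and
      (Measurable.forall fun y => Measurable.imp measurable_const (Measurable.imp measurable_const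
        ((hcell _).iff (hcell _).not)))))

/-- A block coloured "boundary rows `c-1..c+1` black, everything else white" certifies the cut. [folklore] -/
theorem isCutCert_of_pattern (i c : ℤ) (x : Obs)
    (h : ∀ v : Site 2, i ≤ v 0 → v 0 ≤ i + 2 → c - 2 ≤ v 1 → v 1 ≤ c + 2 →
      (v ∈ x.1 ↔ ((v 0 = i ∨ v 0 = i + 2) ∧ c - 1 ≤ v 1 ∧ v 1 ≤ c + 1))) : IsCutCert i c x := by
  have hv : ∀ a yy : ℤ, i ≤ a → a ≤ i + 2 → c - 2 ≤ yy → yy ≤ c + 2 →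
      ((![a, yy] : Site 2) ∈ x.1 ↔ ((a = i ∨ a = i + 2) ∧ c - 1 ≤ yy ∧ yy ≤ c + 1)) :=
    fun a yy h1 h2 h3 h4 => by
      simpa using h ![a, yy] (by simpa using h1) (by simpa using h2) (by simpa using h3) (by simpa using h4)
  have hc0 : (![i, c] : Site 2) ∈ x.1 := (hv i c le_rfl (by omega) (by omega) (by omega)).2 ⟨Or.inl rfl, by omega, by omega⟩
  refine ⟨fun yy h1 h2 => ⟨?_, ?_⟩, ?_, ?_, fun yy h1 h2 => ?_⟩
  · rw [hv i yy le_rfl (by omega) (by omega) (by omega)]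
    exact ⟨fun _ => hc0, fun _ => ⟨Or.inl rfl, h1, h2⟩⟩
  · rw [hv (i + 2) yy (by omega) le_rfl (by omega) (by omega)]
    exact ⟨fun _ => hc0, fun _ => ⟨Or.inr rfl, h1, h2⟩⟩
  · rw [hv i (c - 2) le_rfl (by omega) (by omega) (by omega)]
    constructor
    · rintro ⟨-, h', -⟩; omega
    · intro h'; exact absurd hc0 h'
  · rw [hv i (c + 2) le_rfl (by omega) (by omega) (by omega)]
    constructor
    · rintro ⟨-, -, h'⟩; omega
    · intro h'; exact absurd hc0 h'
  · rw [hv (i + 1) yy (by omega) (by omega) h1 h2]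
    constructor
    · rintro ⟨h', -, -⟩; omega
    · intro h'; exact absurd hc0 h'

/-! ## One block costs a factor `1 - M⁻¹` -/

section Blocks

variable (S : Set ℤ) (i a : ℤ)

/-- Centre of the `j`-th block above the base row `a`: the block occupies the rows `a + 5j, …, a + 5j + 4`. [folklore] -/
def crkCtr (a : ℤ) (j : ℕ) : ℤ := a + 5 * j + 2

/-- "No certificate in the first `j` blocks". [folklore] -/
def crkNoCert (i a : ℤ) (j : ℕ) : Set Obs := {x | ∀ j' : ℕ, j' < j → ¬ IsCutCert i (crkCtr a j') x}

/-- The strip cells of the `j`-th block. [folklore] -/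
def crkCells (i a : ℤ) (j : ℕ) : Finset (Site 2) :=
  (Finset.Icc i (i + 2) ×ˢ Finset.Icc (crkCtr a j - 2) (crkCtr a j + 2)).image fun q : ℤ × ℤ => (![q.1, q.2] : Site 2)

/-- `crkNoCert` is measurable. [folklore] -/
theorem measurableSet_crkNoCert (j : ℕ) : MeasurableSet (crkNoCert i a j) := by
  have : crkNoCert i a j = ⋂ j' ∈ Finset.range j, {x | IsCutCert i (crkCtr a j') x}ᶜ := by
    ext x; simp [crkNoCert]
  rw [this]
  exact Finset.measurableSet_biInter _ fun j' _ => (measurableSet_isCutCert i _).compl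

/-- The next event is the previous one minus the new certificate. [folklore] -/
theorem crkNoCert_succ (j : ℕ) :
    crkNoCert i a (j + 1) = crkNoCert i a j \ {x | IsCutCert i (crkCtr a j) x} := by
  ext x
  simp only [crkNoCert, mem_setOf_eq, mem_sdiff]
  constructor
  · intro h; exact ⟨fun j' hj' => h j' (by omega), h j (by omega)⟩
  · rintro ⟨h1, h2⟩ j' hj'
    rcases Nat.lt_succ_iff_lt_or_eq.1 hj' with h' | rfl
    · exact h1 j' h'
    · exact h2

/-- `crkNoCert i a j` is determined by the strip cells strictly below the `j`-th block. [folklore] -/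
theorem crkNoCert_determined (j : ℕ) :
    crkNoCert i a j ∈ determinedOn {v : Site 2 | i ≤ v 0 ∧ v 0 ≤ i + 2 ∧ v 1 < a + 5 * j} := by
  intro x x' hxx'
  simp only [crkNoCert, mem_setOf_eq]
  refine forall_congr' fun j' => forall_congr' fun hj' => not_congr (isCutCert_congr i _ x x' fun v h1 h2 h3 h4 => ?_)
  refine (hxx' v ⟨h1, h2, ?_⟩).1
  simp only [crkCtr] at h4
  have : (j' : ℤ) + 1 ≤ j := by exact_mod_cast hj'
  linarith

/-- The cells of the `j`-th block are not below it. [folklore] -/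
theorem crkCells_not_below (j : ℕ) :
    ∀ c ∈ crkCells i a j, c ∉ {v : Site 2 | i ≤ v 0 ∧ v 0 ≤ i + 2 ∧ v 1 < a + 5 * j} := by
  intro c hc hmem
  simp only [crkCells, Finset.mem_image, Finset.mem_product, Finset.mem_Icc, crkCtr] at hc
  obtain ⟨q, ⟨-, hq1, -⟩, rfl⟩ := hc
  simp only [mem_setOf_eq, Matrix.cons_val_one, Matrix.cons_val_fin_one] at hmem
  linarith [hmem.2.2]

/-- At most `15` cells per block. [folklore] -/
theorem crkCells_card_le (j : ℕ) : (crkCells i a j).card ≤ 15 := by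
  refine Finset.card_image_le.trans ?_
  rw [Finset.card_product, Int.card_Icc, Int.card_Icc]
  have e1 : (i + 2 + 1 - i : ℤ).toNat = 3 := by
    rw [show (i + 2 + 1 - i : ℤ) = 3 by ring]; rfl
  have e2 : (crkCtr a j + 2 + 1 - (crkCtr a j - 2) : ℤ).toNat = 5 := by
    rw [show (crkCtr a j + 2 + 1 - (crkCtr a j - 2) : ℤ) = 5 by ring]; rfl
  rw [e1, e2]

/-- The prescribed colouring of the `j`-th block implies its certificate. [folklore] -/
theorem crk_cert_of_blockPattern (j : ℕ) (ω : Ω)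
    (h : ∀ c ∈ crkCells i a j, (c ∈ blackSet S ω ↔
      ((c 0 = i ∨ c 0 = i + 2) ∧ crkCtr a j - 1 ≤ c 1 ∧ c 1 ≤ crkCtr a j + 1))) :
    IsCutCert i (crkCtr a j) (obs S ω) := by
  refine isCutCert_of_pattern i _ (obs S ω) fun v h1 h2 h3 h4 => ?_
  have hv : v ∈ crkCells i a j := by
    refine Finset.mem_image.2 ⟨(v 0, v 1), ?_, SDE.site2_eta v⟩
    simp only [Finset.mem_product, Finset.mem_Icc]
    exact ⟨⟨h1, h2⟩, h3, h4⟩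
  exact h v hv

/-- ONE MORE BLOCK COSTS A FACTOR `1 - M⁻¹`: with `M = (2K)^{15}` (single-cell flips of factor `K`),
`μIK(obs⁻¹ noCert_{j+1}) ≤ (1 - M⁻¹) μIK(obs⁻¹ noCert_j)` in real numbers. [folklore] -/
theorem crk_noCert_succ_le {K : ℝ≥0∞}
    (hcell : ∀ c : Site 2, ∃ Φ : Ω → Ω, Measurable Φ ∧ μIK.map Φ ≤ K • μIK ∧
      (∀ ω, (Φ ω).2.2.2.2 = ω.2.2.2.2) ∧
      ∀ (S : Set ℤ) (ω : Ω) (v : Site 2), v ∈ blackSet S (Φ ω) ↔ Xor (v ∈ blackSet S ω) (v = c))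
    (hKtop : K ≠ ∞) (j : ℕ) :
    (μIK (obs S ⁻¹' crkNoCert i a (j + 1))).toReal ≤
      (1 - (((2 * K) ^ 15).toReal)⁻¹) * (μIK (obs S ⁻¹' crkNoCert i a j)).toReal := by
  haveI : IsProbabilityMeasure μIK := by unfold μIK; infer_instance
  obtain ⟨h2K1, hMtop, hMpos⟩ := crsw_factor_props hcell hKtop 15
  have hobs : Measurable (obs S) := (measurable_obs' S).2.2
  set M : ℝ := ((2 * K) ^ 15).toReal with hM
  set Ej := obs S ⁻¹' crkNoCert i a j with hEj
  set Cj := obs S ⁻¹' {x | IsCutCert i (crkCtr a j) x} with hCj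
  have hEjm : MeasurableSet Ej := hobs (measurableSet_crkNoCert i a j)
  have hCjm : MeasurableSet Cj := hobs (measurableSet_isCutCert i _)
  -- (1) the split `Ej = E_{j+1} ⊔ (Ej ∩ Cj)`
  have hsplit : μIK (obs S ⁻¹' crkNoCert i a (j + 1)) + μIK (Ej ∩ Cj) = μIK Ej := by
    rw [crkNoCert_succ, Set.preimage_sdiff, ← hEj, ← hCj, Set.sdiff_eq_compl_inter, Set.inter_comm Cjᶜ Ej]
    rw [add_comm]
    exact measure_inter_add_sdiff Ej hCjm
  -- (2) finite energy: `μ Ej ≤ M μ (Ej ∩ Cj)`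
  have hfe : μIK Ej ≤ (2 * K) ^ 15 * μIK (Ej ∩ Cj) := by
    have key := crk_measure_le_of_pattern hcell S (crkNoCert_determined i a j)
      (fun c : Site 2 => (c 0 = i ∨ c 0 = i + 2) ∧ crkCtr a j - 1 ≤ c 1 ∧ c 1 ≤ crkCtr a j + 1)
      (crkCells i a j) (crkCells_not_below i a j)
    refine key.trans (mul_le_mul' (pow_le_pow_right₀ h2K1 (crkCells_card_le i a j)) (measure_mono ?_))
    rintro ω ⟨hωE, hωB⟩
    exact ⟨hωE, crk_cert_of_blockPattern S i a j ω hωB⟩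
  -- (3) arithmetic in `ℝ`
  have hT : (μIK Ej).toReal = (μIK (obs S ⁻¹' crkNoCert i a (j + 1))).toReal + (μIK (Ej ∩ Cj)).toReal := by
    rw [← hsplit, ENNReal.toReal_add (measure_ne_top _ _) (measure_ne_top _ _)]
  have hfe' : (μIK Ej).toReal ≤ M * (μIK (Ej ∩ Cj)).toReal := by
    rw [hM, ← ENNReal.toReal_mul]
    exact ENNReal.toReal_mono (ENNReal.mul_ne_top hMtop (measure_ne_top _ _)) hfe
  have hMpos' : 0 < M := hMpos
  have hdiv : (μIK Ej).toReal / M ≤ (μIK (Ej ∩ Cj)).toReal := by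
    rw [div_le_iff₀ hMpos']; linarith [mul_comm M (μIK (Ej ∩ Cj)).toReal]
  calc (μIK (obs S ⁻¹' crkNoCert i a (j + 1))).toReal
      = (μIK Ej).toReal - (μIK (Ej ∩ Cj)).toReal := by linarith
    _ ≤ (μIK Ej).toReal - (μIK Ej).toReal / M := by linarith
    _ = (1 - M⁻¹) * (μIK Ej).toReal := by ring

/-- `j` blocks cost `(1 - M⁻¹)^j`. [folklore] -/
theorem crk_noCert_le_pow {K : ℝ≥0∞}
    (hcell : ∀ c : Site 2, ∃ Φ : Ω → Ω, Measurable Φ ∧ μIK.map Φ ≤ K • μIK ∧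
      (∀ ω, (Φ ω).2.2.2.2 = ω.2.2.2.2) ∧
      ∀ (S : Set ℤ) (ω : Ω) (v : Site 2), v ∈ blackSet S (Φ ω) ↔ Xor (v ∈ blackSet S ω) (v = c))
    (hKtop : K ≠ ∞) (j : ℕ) :
    (μIK (obs S ⁻¹' crkNoCert i a j)).toReal ≤ (1 - (((2 * K) ^ 15).toReal)⁻¹) ^ j := by
  haveI : IsProbabilityMeasure μIK := by unfold μIK; infer_instance
  obtain ⟨h2K1, hMtop, hMpos⟩ := crsw_factor_props hcell hKtop 15
  have hM1 : 1 ≤ ((2 * K) ^ 15).toReal := by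
    have : (1 : ℝ≥0∞) ≤ (2 * K) ^ 15 := one_le_pow_of_one_le' h2K1 _
    simpa using ENNReal.toReal_mono hMtop this
  have hq0 : 0 ≤ 1 - (((2 * K) ^ 15).toReal)⁻¹ := by
    rw [sub_nonneg]; exact inv_le_one_of_one_le₀ hM1
  induction j with
  | zero =>
    simp only [pow_zero]
    exact (ENNReal.toReal_mono (measure_ne_top _ _) (measure_mono (Set.subset_univ _))).trans (by simp)
  | succ j ih =>
    calc (μIK (obs S ⁻¹' crkNoCert i a (j + 1))).toReal
        ≤ (1 - (((2 * K) ^ 15).toReal)⁻¹) * (μIK (obs S ⁻¹' crkNoCert i a j)).toReal :=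
          crk_noCert_succ_le S i a hcell hKtop j
      _ ≤ (1 - (((2 * K) ^ 15).toReal)⁻¹) * (1 - (((2 * K) ^ 15).toReal)⁻¹) ^ j :=
          mul_le_mul_of_nonneg_left ih hq0
      _ = _ := by ring

end Blocks

/-! ## The registered tail bound -/

/-- Single-cell flips of the explicit gauge, with a finite factor. [folklore] -/
theorem crk_cellFlips : ∃ K : ℝ≥0∞, K ≠ ∞ ∧ ∀ c : Site 2, ∃ Φ : Ω → Ω, Measurable Φ ∧ μIK.map Φ ≤ K • μIK ∧
    (∀ ω, (Φ ω).2.2.2.2 = ω.2.2.2.2) ∧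
    ∀ (S : Set ℤ) (ω : Ω) (v : Site 2), v ∈ blackSet S (Φ ω) ↔ Xor (v ∈ blackSet S ω) (v = c) :=
  ⟨_, ENNReal.pow_ne_top faceFlip_factor_ne_top, fun c =>
    exists_cellFlip (R := fun T ω => ((ω.1 ∆ T, ω.2) : Ω)) (C := fun T ω => ((ω.1, ω.2.1 ∆ T, ω.2.2) : Ω))
      (F := fun g ω => ((ω.1, ω.2.1, ω.2.2.1 ∆ {g}, ω.2.2.2.1 ∆ {g}, ω.2.2.2.2) : Ω))
      rowFlip_spec colFlip_spec faceFlip_spec c⟩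

/-- No cut row in the window ⟹ no certificate in any of the `⌊m/5⌋` blocks of the window. [folklore] -/
theorem crk_noCut_subset_noCert (i y : ℤ) (m : ℕ) :
    {x : Obs | ∀ c' : ℤ, y - m - 1 ≤ c' → c' ≤ y - 1 → ¬ IsCut i c' (pinnedStat i x)} ⊆
      crkNoCert i (y - m - 1) (m / 5) := by
  intro x hx j' hj' hcert
  refine hx (crkCtr (y - m - 1) j') ?_ ?_ (isCut_pinnedStat_of_cert i _ x hcert)
  · simp only [crkCtr]; omega
  · simp only [crkCtr]
    have h5 : 5 * (m / 5) ≤ m := Nat.mul_div_le m 5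
    have : (j' : ℤ) + 1 ≤ (m / 5 : ℕ) := by exact_mod_cast hj'
    push_cast at this h5 ⊢
    have h5' : (5 : ℤ) * ((m / 5 : ℕ) : ℤ) ≤ m := by exact_mod_cast h5
    linarith

/-- EXPONENTIAL TAIL OF THE DISTANCE TO THE LAST CUT ROW (registered sub-goal `isCut_tail`): for absolute
constants `C, c > 0` and EVERY column pattern `S`, face column `i`, row `y` and depth `m`, the
`νmix S`-probability that none of the rows `y-m-1, …, y-1` is a cut row of the pinned statistic is at
most `C e^{-cm}`. [folklore] -/
theorem isCut_tail : ∃ C c : ℝ, 0 < c ∧ 0 ≤ C ∧ ∀ (S : Set ℤ) (i y : ℤ) (m : ℕ),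
    (νmix S) {x | ∀ c' : ℤ, y - m - 1 ≤ c' → c' ≤ y - 1 → ¬ IsCut i c' (pinnedStat i x)} ≤
      ENNReal.ofReal (C * Real.exp (-c * m)) := by
  obtain ⟨K, hKtop, hcell⟩ := crk_cellFlips
  haveI : IsProbabilityMeasure μIK := by unfold μIK; infer_instance
  obtain ⟨h2K1, hMtop, hMpos⟩ := crsw_factor_props hcell hKtop 15
  set M : ℝ := ((2 * K) ^ 15).toReal with hM
  set c : ℝ := (5 * M)⁻¹ with hc
  have hcpos : 0 < c := by positivity
  refine ⟨Real.exp (4 * c), c, hcpos, (Real.exp_pos _).le, fun S i y m => ?_⟩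
  haveI := isProbabilityMeasure_nuMix S
  have hobs : Measurable (obs S) := (measurable_obs' S).2.2
  -- the bad event inside `noCert`, measured through `μIK`
  have h1 : (νmix S) {x | ∀ c' : ℤ, y - m - 1 ≤ c' → c' ≤ y - 1 → ¬ IsCut i c' (pinnedStat i x)} ≤
      μIK (obs S ⁻¹' crkNoCert i (y - m - 1) (m / 5)) := by
    refine (measure_mono (crk_noCut_subset_noCert i y m)).trans (le_of_eq ?_)
    rw [νmix, Measure.map_apply hobs (measurableSet_crkNoCert i _ _)]
  have h2 : (μIK (obs S ⁻¹' crkNoCert i (y - m - 1) (m / 5))).toReal ≤ (1 - M⁻¹) ^ (m / 5) :=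
    crk_noCert_le_pow S i (y - m - 1) hcell hKtop (m / 5)
  -- `(1 - M⁻¹)^{⌊m/5⌋} ≤ e^{4c} e^{-cm}`
  have hM1 : 1 ≤ M := by
    have : (1 : ℝ≥0∞) ≤ (2 * K) ^ 15 := one_le_pow_of_one_le' h2K1 _
    simpa [hM] using ENNReal.toReal_mono hMtop this
  have hq0 : 0 ≤ 1 - M⁻¹ := by rw [sub_nonneg]; exact inv_le_one_of_one_le₀ hM1
  have hq1 : 1 - M⁻¹ ≤ Real.exp (-M⁻¹) := Real.one_sub_le_exp_neg _
  have h3 : (1 - M⁻¹) ^ (m / 5) ≤ Real.exp (4 * c) * Real.exp (-c * m) := by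
    calc (1 - M⁻¹) ^ (m / 5) ≤ (Real.exp (-M⁻¹)) ^ (m / 5) := pow_le_pow_left₀ hq0 hq1 _
      _ = Real.exp (-M⁻¹ * (m / 5 : ℕ)) := by rw [← Real.exp_nat_mul]; ring_nf
      _ ≤ Real.exp (4 * c + -c * m) := by
          refine Real.exp_le_exp.2 ?_
          have h5 : (m : ℝ) ≤ 5 * ((m / 5 : ℕ) : ℝ) + 4 := by
            have := Nat.lt_mul_div_succ m (show 0 < 5 by norm_num)
            have : (m : ℝ) + 1 ≤ 5 * (((m / 5 : ℕ) : ℝ) + 1) := by exact_mod_cast this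
            linarith
          have hMinv : M⁻¹ = 5 * c := by rw [hc]; field_simp
          rw [hMinv]
          nlinarith [hcpos]
      _ = Real.exp (4 * c) * Real.exp (-c * m) := Real.exp_add _ _
  calc (νmix S) {x | ∀ c' : ℤ, y - m - 1 ≤ c' → c' ≤ y - 1 → ¬ IsCut i c' (pinnedStat i x)}
      ≤ μIK (obs S ⁻¹' crkNoCert i (y - m - 1) (m / 5)) := h1
    _ = ENNReal.ofReal ((μIK (obs S ⁻¹' crkNoCert i (y - m - 1) (m / 5))).toReal) :=
        (ENNReal.ofReal_toReal (measure_ne_top _ _)).symm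
    _ ≤ ENNReal.ofReal (Real.exp (4 * c) * Real.exp (-c * m)) := ENNReal.ofReal_le_ofReal (h2.trans h3)

end Summit.CriticalPhenomena.CardyFormulaZ2.Theorems.IKLinearTransport.PinnedDiagramExchange
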